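/-
Copyright: cell pub-balaban-gaps (YM BLITZ Y1, track G1), seat g1-p2 GEN 11 (unit `pub-balaban-gaps-g1-p2`).  Row (D4) NODE O, OBJECT ∕
MECHANISM level: the GRADIENT-DOMINATION hypothesis of `D4WalkBlockFormCoercive.conjCoercive_of_gradient` (`Σ_μ‖∇̃_μz‖² ≤ γ·Re conjForm A₀ z
+ c_D‖z‖²`, `∇̃_μ = conjMat ∇_μ` the CONJUGATED gradient) SUPPLIED from the GRAM STRUCTURE of the flat operator — `A₀ = Σ_μ ∇_μᴴ∇_μ + P`,
`P` `Re`-nonnegative with a conjugation defect — and ONE letter of each gradient: the `ℓ²` size `δ` of its conjugation defect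
`conjMat (±κ) ∇_μ − ∇_μ` (for `∇_μ = η⁻¹(S_μ − 1)` and an `η`-Lipschitz weight: `δ = η⁻¹(e^{κη} − 1) ≤ κe^{κη}`, FREE OF `η⁻¹`); plus the
extension of a dominated family by bounded conjugated transports (`S_μ⁻¹∇_μ` next to `∇_μ`).  HONEST FRAMING: mechanism ([folklore]:
Cauchy–Schwarz); the Gram presentation, the defect letters and `P`'s data are hypotheses; Bałaban's `Δ^{(k)}(𝐔)` NOT constructed; (D4) instance
0∕1; NOT BetaPertH, NOT continuum, NOT Clay.
-/
import Summits.QuantumFields.BalabanUV.T4Continuum.Support.CTWeightedCoercivity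

/-!
# `Gaps.D4WalkBlockFormGradient` — gradient domination of the conjugated gradients from the Gram structure `A₀ = Σ_μ ∇_μᴴ∇_μ + P` and the
# conjugation-defect letters of the gradients (cell pub-balaban-gaps, seat g1-p2 gen 11)

HONEST DEPENDENCY (cell pub-balaban, verbatim): continuum YM on T⁴ ⇐ BetaPertH ∧ nine spine estimates (0/9 proved); BetaPertH ⇐ (D1) ∧ (D4) ∧ CAP+tail.

[B9] Thms 3.1–3.3 p. 397–399 ∕ (3.42): the flat operator `Δ′ = Σ_μ ∇_μ*∇_μ + (mass, averaging)` is bounded below, and its quadratic form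
CONTAINS `Σ_μ‖∇_μ z‖²`; conjugating by the Combes–Thomas weight `e^{κρ}` moves each gradient by a defect of size `κ` (NOT `κη⁻¹`) when `ρ` is
Lipschitz in lattice units.  ABSTRACTLY ([folklore] throughout):
* §1 `conjMat_conjTranspose` (`conjMat κ Xᴴ = (conjMat (−κ) X)ᴴ`), **`conjForm_gram`** (`conjForm (XᴴX) z = ⟨conjMat (−κ) X z, conjMat κ X z⟩`),
  `nsq_add_eq`;
* §2 **`nsq_conjGrad_le`**: `‖conjMat κ ∇ z‖² ≤ 2·Re conjForm (∇ᴴ∇) z + 4δ²‖z‖²` from the two defect letters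
  `‖(conjMat (±κ) ∇ − ∇)z‖² ≤ δ²‖z‖²` (the cross terms `⟨∇z, (conjMat κ ∇ − ∇)z⟩` CANCEL between the two sides);
* §3 `re_conjForm_ge_of_nonneg_conjDefect` (a `Re`-nonnegative `P` with conjugation defect `J` costs `J`), **`gradDom_of_gram`**: for
  `A₀` with `Re conjForm (A₀ − Σ_μ ∇_μᴴ∇_μ) z ≥ −c′‖z‖²`: `Σ_μ‖conjMat κ ∇_μ z‖² ≤ 2·Re conjForm A₀ z + (2c′ + 4·#μ·δ²)‖z‖²` — the shape `hD` of
  `D4WalkBlockFormCoercive.conjCoercive_of_gradient` with `γ = 2`;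
* §4 **`gradDom_sum_extend`**: a dominated family `∇_μ` and transports `T_μ` with `‖conjMat κ T_μ y‖² ≤ θ‖y‖²` give the dominated family
  `∇_μ, T_μ∇_μ` on `μs ⊕ μs` with constants `(1 + θ)γ`, `(1 + θ)c_D` (the backward members `S_μ⁻¹∇_μ` of (3.52)–(3.54)).
WHAT IT IS NOT.  The instance (59b's `covLap(1) = ε⁻²Σ_μ(2 − S_μ − S_μ⁻¹)` as `Σ_μ ∇_μᴴ∇_μ`, the defect letter of `ε⁻¹(S_μ − 1)` for the torus
weight, the averaging term's data) is NOT here; (D4) instance 0∕1; words of row (D4) UNCHANGED.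

References (method only): T. Bałaban, Comm. Math. Phys. **99** (1985) 389–434 [B9], Thms 3.1–3.3 pp. 397–399, (3.42) p. 399, (3.52)–(3.54)
pp. 400–401, Cor. 3.6 p. 408; J.-M. Combes, L. Thomas, Comm. Math. Phys. **34** (1973) 251–270.
-/

noncomputable section

namespace Summit.QuantumFields.BalabanUV.Gaps.D4WalkBlockFormGradient

open Finset Complex Matrix
open scoped BigOperators Matrix ComplexConjugate
open Literature.MathematicalPhysics.QuantumFieldTheory.Balaban1983to89.B5Prop11Lower (nsq nsq_nonneg star_dotProduct_self
  norm_star_dotProduct_le)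
open Summit.QuantumFields.BalabanUV.Beta.AccretiveCombesThomas (conjForm conjForm_add)
open Summit.QuantumFields.BalabanUV.T4Continuum.CTWeightedCoercivity (conjMat conjMat_apply conjMat_mul conjMat_sub conjForm_eq ConjDefect)

variable {ι : Type*} [Fintype ι]

/-! ## §1. The conjugated Gram form -/

omit [Fintype ι] in
/-- conjugating the adjoint: `conjMat κ Xᴴ = (conjMat (−κ) X)ᴴ`. [folklore] -/
theorem conjMat_conjTranspose (κ : ℝ) (ρ : ι → ℝ) (X : Matrix ι ι ℂ) :
    conjMat κ ρ ρ Xᴴ = (conjMat (-κ) ρ ρ X)ᴴ := by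
  ext e e'
  rw [conjMat_apply, Matrix.conjTranspose_apply, Matrix.conjTranspose_apply, conjMat_apply, star_mul', Complex.star_def,
    Complex.conj_ofReal, show -κ * (ρ e' - ρ e) = κ * (ρ e - ρ e') by ring]

/-- **the conjugated GRAM form**: `conjForm (XᴴX) z = ⟨conjMat (−κ) X z, conjMat κ X z⟩`. [folklore] -/
theorem conjForm_gram (X : Matrix ι ι ℂ) (κ : ℝ) (ρ : ι → ℝ) (z : ι → ℂ) :
    conjForm (Xᴴ * X) κ ρ z = star (conjMat (-κ) ρ ρ X *ᵥ z) ⬝ᵥ (conjMat κ ρ ρ X *ᵥ z) := by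
  rw [conjForm_eq, conjMat_mul κ ρ ρ ρ, conjMat_conjTranspose, ← Matrix.mulVec_mulVec, Matrix.dotProduct_mulVec, ← Matrix.star_mulVec]

/-- `‖p + q‖² = ‖p‖² + 2Re⟨p, q⟩ + ‖q‖²` (with `Re⟨q, p⟩ = Re⟨p, q⟩` — the tree's `star_dotProduct_comm_re` pattern, inlined). [folklore] -/
theorem nsq_add_eq (p q : ι → ℂ) : nsq (p + q) = nsq p + 2 * (star p ⬝ᵥ q).re + nsq q := by
  have hsymm : (star q ⬝ᵥ p).re = (star p ⬝ᵥ q).re := by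
    have h : star q ⬝ᵥ p = (starRingEnd ℂ) (star p ⬝ᵥ q) := by
      simp only [dotProduct, map_sum, Pi.star_apply, Complex.star_def, map_mul, Complex.conj_conj]
      exact Finset.sum_congr rfl fun i _ => mul_comm _ _
    rw [h, Complex.conj_re]
  have h : ((nsq (p + q) : ℝ) : ℂ) = ((nsq p : ℝ) : ℂ) + star p ⬝ᵥ q + star q ⬝ᵥ p + ((nsq q : ℝ) : ℂ) := by
    rw [← star_dotProduct_self, ← star_dotProduct_self, ← star_dotProduct_self, star_add, add_dotProduct, dotProduct_add,
      dotProduct_add]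
    ring
  have h' := congrArg Complex.re h
  rw [Complex.ofReal_re, Complex.add_re, Complex.add_re, Complex.add_re, Complex.ofReal_re, Complex.ofReal_re, hsymm] at h'
  linarith

/-! ## §2. One gradient: `‖conjMat κ ∇ z‖² ≤ 2·Re conjForm (∇ᴴ∇) z + 4δ²‖z‖²` -/

/-- **THE CONJUGATED GRADIENT IS DOMINATED BY THE CONJUGATED GRAM FORM** up to the defect letter: if `‖(conjMat (±κ) ∇ − ∇)z‖² ≤ δ²‖z‖²`
then `‖conjMat κ ∇ z‖² ≤ 2·Re conjForm (∇ᴴ∇) z + 4δ²·‖z‖²` (expand both sides at `∇z`: the cross terms cancel, the rest is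
`(‖∇z‖ − δ‖z‖)² ≥ 0`). [folklore] [cite: Balaban1985BackgroundPropagators, (3.42) p.399, Cor. 3.6 p.408] -/
theorem nsq_conjGrad_le (D : Matrix ι ι ℂ) (κ : ℝ) (ρ : ι → ℝ) {δ : ℝ} (hδ : 0 ≤ δ)
    (hp : ∀ z, nsq ((conjMat κ ρ ρ D - D) *ᵥ z) ≤ δ ^ 2 * nsq z)
    (hm : ∀ z, nsq ((conjMat (-κ) ρ ρ D - D) *ᵥ z) ≤ δ ^ 2 * nsq z) (z : ι → ℂ) :
    nsq (conjMat κ ρ ρ D *ᵥ z) ≤ 2 * (conjForm (Dᴴ * D) κ ρ z).re + 4 * δ ^ 2 * nsq z := by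
  set p := D *ᵥ z with hpdef
  set qp := (conjMat κ ρ ρ D - D) *ᵥ z with hqp
  set qm := (conjMat (-κ) ρ ρ D - D) *ᵥ z with hqm
  have hDp : conjMat κ ρ ρ D *ᵥ z = p + qp := by rw [hqp, Matrix.sub_mulVec, hpdef, add_sub_cancel]
  have hDm : conjMat (-κ) ρ ρ D *ᵥ z = p + qm := by rw [hqm, Matrix.sub_mulVec, hpdef, add_sub_cancel]
  -- the two sides at `p`
  have hL : nsq (conjMat κ ρ ρ D *ᵥ z) = nsq p + 2 * (star p ⬝ᵥ qp).re + nsq qp := by rw [hDp, nsq_add_eq]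
  have hR : (conjForm (Dᴴ * D) κ ρ z).re = nsq p + (star p ⬝ᵥ qp).re + (star qm ⬝ᵥ p).re + (star qm ⬝ᵥ qp).re := by
    rw [conjForm_gram, hDp, hDm, star_add, add_dotProduct, dotProduct_add, dotProduct_add, star_dotProduct_self]
    simp only [Complex.add_re, Complex.ofReal_re]
    ring
  -- square roots
  set sP := Real.sqrt (nsq p) with hsP
  set sn := Real.sqrt (nsq z) with hsn
  have hsP0 : 0 ≤ sP := Real.sqrt_nonneg _
  have hsn0 : 0 ≤ sn := Real.sqrt_nonneg _
  have hPsq : sP ^ 2 = nsq p := Real.sq_sqrt (nsq_nonneg _)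
  have hnsq : sn ^ 2 = nsq z := Real.sq_sqrt (nsq_nonneg _)
  have hsq_le : ∀ q : ι → ℂ, nsq q ≤ δ ^ 2 * nsq z → Real.sqrt (nsq q) ≤ δ * sn := fun q hq => by
    calc Real.sqrt (nsq q) ≤ Real.sqrt (δ ^ 2 * nsq z) := Real.sqrt_le_sqrt hq
      _ = δ * sn := by rw [Real.sqrt_mul (sq_nonneg _), Real.sqrt_sq hδ]
  have hqm' : Real.sqrt (nsq qm) ≤ δ * sn := hsq_le qm (hm z)
  have hqp' : Real.sqrt (nsq qp) ≤ δ * sn := hsq_le qp (hp z)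
  -- Cauchy–Schwarz on the two cross terms that do not cancel
  have hb : -(δ * sn * sP) ≤ (star qm ⬝ᵥ p).re := by
    have h1 : ‖star qm ⬝ᵥ p‖ ≤ Real.sqrt (nsq qm) * sP := norm_star_dotProduct_le qm p
    have h2 : Real.sqrt (nsq qm) * sP ≤ δ * sn * sP := mul_le_mul_of_nonneg_right hqm' hsP0
    have h3 := Complex.abs_re_le_norm (star qm ⬝ᵥ p)
    linarith [neg_abs_le (star qm ⬝ᵥ p).re]
  have hc : -(δ ^ 2 * nsq z) ≤ (star qm ⬝ᵥ qp).re := by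
    have h1 : ‖star qm ⬝ᵥ qp‖ ≤ Real.sqrt (nsq qm) * Real.sqrt (nsq qp) := norm_star_dotProduct_le qm qp
    have h2 : Real.sqrt (nsq qm) * Real.sqrt (nsq qp) ≤ (δ * sn) * (δ * sn) :=
      mul_le_mul hqm' hqp' (Real.sqrt_nonneg _) (mul_nonneg hδ hsn0)
    have h3 := Complex.abs_re_le_norm (star qm ⬝ᵥ qp)
    have e : (δ * sn) * (δ * sn) = δ ^ 2 * nsq z := by rw [← hnsq]; ring
    linarith [neg_abs_le (star qm ⬝ᵥ qp).re]
  have hQp : nsq qp ≤ δ ^ 2 * nsq z := hp z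
  have e1 : (sP - δ * sn) ^ 2 = nsq p - 2 * (δ * sn * sP) + δ ^ 2 * nsq z := by rw [← hPsq, ← hnsq]; ring
  have e0 : 0 ≤ (sP - δ * sn) ^ 2 := sq_nonneg _
  rw [hL, hR]
  linarith

/-! ## §3. The family: gradient domination from the Gram structure of `A₀` -/

/-- a `Re`-nonnegative part with conjugation defect `J` costs `J`: `−J‖z‖² ≤ Re conjForm P z`. [folklore] -/
theorem re_conjForm_ge_of_nonneg_conjDefect (P : Matrix ι ι ℂ) (κ : ℝ) (ρ : ι → ℝ) {J : ℝ}
    (hP : ∀ z : ι → ℂ, 0 ≤ (star z ⬝ᵥ (P *ᵥ z)).re) (hJ : ConjDefect P κ ρ J) (z : ι → ℂ) :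
    -(J * nsq z) ≤ (conjForm P κ ρ z).re := by
  have h := hJ z
  rw [abs_le] at h
  linarith [hP z, h.1]

variable {μs : Type*} [Fintype μs]

/-- finite additivity of the conjugated form in the kernel (local copy of the one-line induction; the `D4WalkBlockFormCoercive` version is
not imported so that the two mechanism files build independently). [folklore] -/
theorem conjForm_sum (M : μs → Matrix ι ι ℂ) (κ : ℝ) (ρ : ι → ℝ) (z : ι → ℂ) :
    conjForm (∑ μ, M μ) κ ρ z = ∑ μ, conjForm (M μ) κ ρ z := by
  classical
  induction (Finset.univ : Finset μs) using Finset.cons_induction with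
  | empty => simp [conjForm]
  | cons a s ha ih => rw [Finset.sum_cons, Finset.sum_cons, conjForm_add, ih]

/-- **GRADIENT DOMINATION FROM THE GRAM STRUCTURE.**  Gradients `∇_μ` with defect letters `δ` at `±κ`, and a flat operator `A₀` whose
remainder `A₀ − Σ_μ ∇_μᴴ∇_μ` costs at most `c′` in conjugated form (`Re conjForm (A₀ − Σ_μ∇_μᴴ∇_μ) z ≥ −c′‖z‖²`: mass ≥ 0, averaging term
`Re`-nonnegative with a conjugation defect) ⟹ `Σ_μ‖conjMat κ ∇_μ z‖² ≤ 2·Re conjForm A₀ z + (2c′ + 4·#μ·δ²)‖z‖²` — the `hD` shape of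
`D4WalkBlockFormCoercive.conjCoercive_of_gradient` with `γ = 2`. [folklore] [cite: Balaban1985BackgroundPropagators, Thms 3.1–3.3 p.399, (3.42) p.399, Cor. 3.6 p.408] -/
theorem gradDom_of_gram (A₀ : Matrix ι ι ℂ) (D : μs → Matrix ι ι ℂ) (κ : ℝ) (ρ : ι → ℝ) {δ c' : ℝ} (hδ : 0 ≤ δ)
    (hp : ∀ μ z, nsq ((conjMat κ ρ ρ (D μ) - D μ) *ᵥ z) ≤ δ ^ 2 * nsq z)
    (hm : ∀ μ z, nsq ((conjMat (-κ) ρ ρ (D μ) - D μ) *ᵥ z) ≤ δ ^ 2 * nsq z)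
    (hrest : ∀ z, -(c' * nsq z) ≤ (conjForm (A₀ - ∑ μ, (D μ)ᴴ * D μ) κ ρ z).re) (z : ι → ℂ) :
    ∑ μ, nsq (conjMat κ ρ ρ (D μ) *ᵥ z) ≤ 2 * (conjForm A₀ κ ρ z).re + (2 * c' + 4 * Fintype.card μs * δ ^ 2) * nsq z := by
  have h1 : ∑ μ, nsq (conjMat κ ρ ρ (D μ) *ᵥ z) ≤ ∑ μ, (2 * (conjForm ((D μ)ᴴ * D μ) κ ρ z).re + 4 * δ ^ 2 * nsq z) :=
    Finset.sum_le_sum fun μ _ => nsq_conjGrad_le (D μ) κ ρ hδ (hp μ) (hm μ) z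
  have h2 : ∑ μ, (2 * (conjForm ((D μ)ᴴ * D μ) κ ρ z).re + 4 * δ ^ 2 * nsq z)
      = 2 * (conjForm (∑ μ, (D μ)ᴴ * D μ) κ ρ z).re + 4 * Fintype.card μs * δ ^ 2 * nsq z := by
    rw [Finset.sum_add_distrib, Finset.sum_const, Finset.card_univ, nsmul_eq_mul, conjForm_sum, Complex.re_sum, Finset.mul_sum]
    ring
  have h3 : conjForm A₀ κ ρ z = conjForm (∑ μ, (D μ)ᴴ * D μ) κ ρ z + conjForm (A₀ - ∑ μ, (D μ)ᴴ * D μ) κ ρ z := by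
    rw [← conjForm_add, add_sub_cancel]
  have h4 := hrest z
  rw [h3, Complex.add_re]
  linarith

/-! ## §4. Extending a dominated family by bounded conjugated transports -/

/-- **EXTENSION BY TRANSPORTS**: a dominated family `∇_μ` (`Σ_μ‖conjMat κ ∇_μ z‖² ≤ γ·Re conjForm A₀ z + c_D‖z‖²`) and transports `T_μ` with
`‖conjMat κ T_μ y‖² ≤ θ‖y‖²` (`θ ≥ 0`) give the dominated family `μ ↦ ∇_μ`, `μ ↦ T_μ∇_μ` on `μs ⊕ μs` with constants `(1 + θ)γ`, `(1 + θ)c_D`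
(the backward members `S_μ⁻¹∇_μ` of (3.52)–(3.54) next to the forward ones). [folklore] [cite: Balaban1985BackgroundPropagators, (3.52)–(3.54) pp.400–401] -/
theorem gradDom_sum_extend (A₀ : Matrix ι ι ℂ) (D T : μs → Matrix ι ι ℂ) (κ : ℝ) (ρ : ι → ℝ) {γ cD θ : ℝ} (hθ : 0 ≤ θ)
    (hD : ∀ z, ∑ μ, nsq (conjMat κ ρ ρ (D μ) *ᵥ z) ≤ γ * (conjForm A₀ κ ρ z).re + cD * nsq z)
    (hT : ∀ μ y, nsq (conjMat κ ρ ρ (T μ) *ᵥ y) ≤ θ * nsq y) (z : ι → ℂ) :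
    ∑ s : μs ⊕ μs, nsq (conjMat κ ρ ρ (Sum.elim D (fun μ => T μ * D μ) s) *ᵥ z)
      ≤ (1 + θ) * γ * (conjForm A₀ κ ρ z).re + (1 + θ) * cD * nsq z := by
  rw [Fintype.sum_sum_type]
  simp only [Sum.elim_inl, Sum.elim_inr]
  have h2 : ∑ μ, nsq (conjMat κ ρ ρ (T μ * D μ) *ᵥ z) ≤ θ * ∑ μ, nsq (conjMat κ ρ ρ (D μ) *ᵥ z) := by
    rw [Finset.mul_sum]
    refine Finset.sum_le_sum fun μ _ => ?_
    rw [conjMat_mul κ ρ ρ ρ, ← Matrix.mulVec_mulVec]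
    exact hT μ _
  have h1 := hD z
  have h0 : 0 ≤ ∑ μ, nsq (conjMat κ ρ ρ (D μ) *ᵥ z) := Finset.sum_nonneg fun μ _ => nsq_nonneg _
  nlinarith [mul_le_mul_of_nonneg_left h1 hθ]

end Summit.QuantumFields.BalabanUV.Gaps.D4WalkBlockFormGradient

end
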